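import Summits.Langlands.Langlands.Theorems.MonomialSerreAtSplitPrimes.Negative.CentralHeckeNeighbourhoods

/-!
# `MonomialSerreAtSplitPrimes` (stmt-Langlands-16951), negative side II: places of `ℚ` and the test idèle

Part 2 of the chain (supports stmt-Langlands-16951).  §4: the place `(ℓ)` of `ℚ` at a rational prime
(`prime_span_natCast`, `residueCard = ℓ`), integral valuations of `ℓ` and `ℓ + 1`, the valuation of the
diagonal image of a rational number, and the TEST IDÈLE `y = r⁻¹ · (ϖ at (ℓ), 1 elsewhere)` for
`r = -ℓ`: the local idèle of `ϖ` is `r·y`; `y` and `y⁻¹` are integral at every place; and at a place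
`w ≠ (ℓ)` with `ℓ + 1 ∈ 𝔭_w^n` both `y_w - 1` and `y_w⁻¹ - 1` have valuation `≤ exp(-n)`.
Mathlib only. [folklore]
-/

noncomputable section

set_option linter.dupNamespace false -- `Summit.Langlands.Langlands` is the mandated namespace (D-0017)

open scoped NumberField Classical Polynomial Topology RestrictedProduct
open IsDedekindDomain NumberField Polynomial Filter
open Literature.NumberTheory.Automorphic Literature.NumberTheory.GaloisRepresentations

namespace Summit.Langlands.Langlands.Theorems.MonomialSerreAtSplitPrimes.Negative

/-! ## 4. Places of `ℚ` at rational primes; the test idèle `y = (-ℓ)⁻¹ · ϖ_v` -/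

section RatPlaces

/-- `N((ℓ)) = ℓ` in `𝓞 ℚ`. [folklore] -/
theorem absNorm_span_natCast (ℓ : ℕ) : Ideal.absNorm (Ideal.span {(ℓ : 𝓞 ℚ)}) = ℓ := by
  rw [Ideal.absNorm_span_singleton, show ((ℓ : ℕ) : 𝓞 ℚ) = algebraMap ℤ (𝓞 ℚ) (ℓ : ℤ) by simp,
    Algebra.norm_algebraMap, RingOfIntegers.rank, Module.finrank_self, pow_one, Int.natAbs_natCast]

/-- For a rational prime `ℓ`, the ideal `(ℓ) ⊂ 𝓞 ℚ` is a nonzero prime (its norm `ℓ` is prime), i.e.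
a finite place of `ℚ` (`HeightOneSpectrum.ofPrime`). [folklore] -/
theorem prime_span_natCast {ℓ : ℕ} (hℓ : ℓ.Prime) : Prime (Ideal.span {(ℓ : 𝓞 ℚ)}) :=
  Ideal.prime_of_isPrime
    (by rw [Ne, Ideal.span_singleton_eq_bot]; exact_mod_cast hℓ.ne_zero)
    (Ideal.isPrime_of_irreducible_absNorm (by rw [absNorm_span_natCast]; exact hℓ))

/-- The valuation of a natural number at a place of `ℚ` is its integral valuation. [folklore] -/
theorem valuation_natCast (w : HeightOneSpectrum (𝓞 ℚ)) (n : ℕ) :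
    w.valuation ℚ (n : ℚ) = w.intValuation (n : 𝓞 ℚ) := by
  rw [show (n : ℚ) = algebraMap (𝓞 ℚ) ℚ (n : 𝓞 ℚ) by rw [map_natCast]]
  exact HeightOneSpectrum.valuation_of_algebraMap w (n : 𝓞 ℚ)

/-- If `m ∈ 𝔭_w^n` then `v_w(m) ≤ exp(-n)`. [folklore] -/
theorem valuation_natCast_le_of_mem_pow {w : HeightOneSpectrum (𝓞 ℚ)} {m n : ℕ}
    (h : (m : 𝓞 ℚ) ∈ w.asIdeal ^ n) : w.valuation ℚ (m : ℚ) ≤ WithZero.exp (-(n : ℤ)) := by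
  rw [valuation_natCast]
  exact (HeightOneSpectrum.intValuation_le_pow_iff_mem _ _ _).2 h

/-- The valuation of the diagonal image of `q ∈ ℚ` at `w` is `v_w(q)`. [folklore] -/
theorem valued_algebraMap_apply (w : HeightOneSpectrum (𝓞 ℚ)) (q : ℚ) :
    Valued.v (algebraMap ℚ (FiniteAdeleRing (𝓞 ℚ) ℚ) q w) = w.valuation ℚ q := by
  rw [IsDedekindDomain.FiniteAdeleRing.algebraMap_apply]
  exact HeightOneSpectrum.valuedAdicCompletion_eq_valuation' w q

/-- `(q)_w - 1 = (q - 1)_w`. [folklore] -/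
theorem algebraMap_apply_sub_one (w : HeightOneSpectrum (𝓞 ℚ)) (q : ℚ) :
    algebraMap ℚ (FiniteAdeleRing (𝓞 ℚ) ℚ) q w - 1 = algebraMap ℚ (FiniteAdeleRing (𝓞 ℚ) ℚ) (q - 1) w := by
  rw [map_sub, map_one]
  rfl

variable {ℓ : ℕ} (hℓ : ℓ.Prime) {v : HeightOneSpectrum (𝓞 ℚ)}
  (hv : v.asIdeal = Ideal.span {(ℓ : 𝓞 ℚ)})

include hv in
/-- `q_{(ℓ)} = ℓ`. [folklore] -/
theorem residueCard_eq_of_asIdeal_eq : v.residueCard = ℓ := by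
  show Ideal.absNorm v.asIdeal = ℓ
  rw [hv, absNorm_span_natCast]

include hv in
/-- `ℓ ∈ (ℓ)`. [folklore] -/
theorem natCast_mem_of_asIdeal_eq : (ℓ : 𝓞 ℚ) ∈ v.asIdeal :=
  hv ▸ Ideal.mem_span_singleton_self _

include hv in
/-- A place of `ℚ` containing `ℓ` is `(ℓ)` (maximality of `(ℓ)`). [folklore] -/
theorem eq_of_natCast_mem {w : HeightOneSpectrum (𝓞 ℚ)} (h : (ℓ : 𝓞 ℚ) ∈ w.asIdeal) : w = v := by
  have hle : v.asIdeal ≤ w.asIdeal := by rw [hv]; exact (Ideal.span_singleton_le_iff_mem _).2 h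
  exact HeightOneSpectrum.ext (v.isMaximal.eq_of_le w.isPrime.ne_top hle).symm

include hv in
/-- At a place `w ≠ (ℓ)`, `ℓ` is a unit: `v_w(ℓ) = 1`. [folklore] -/
theorem valuation_natCast_of_ne {w : HeightOneSpectrum (𝓞 ℚ)} (hw : w ≠ v) :
    w.valuation ℚ (ℓ : ℚ) = 1 := by
  rw [valuation_natCast, HeightOneSpectrum.intValuation_eq_one_iff]
  exact fun h => hw (eq_of_natCast_mem hv h)

include hℓ hv in
/-- At the place `(ℓ)`, `ℓ` is a uniformiser: `v_{(ℓ)}(ℓ) = exp(-1)`. [folklore] -/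
theorem valuation_natCast_self : v.valuation ℚ (ℓ : ℚ) = WithZero.exp (-1 : ℤ) := by
  rw [valuation_natCast]
  exact HeightOneSpectrum.intValuation_singleton _ (by exact_mod_cast hℓ.ne_zero) hv

variable (r : ℚˣ) (ϖ : (v.adicCompletion ℚ)ˣ)

omit hℓ in
/-- The local idèle of `ϖ` is `r · y`, `y = r⁻¹ · (ϖ at v, 1 elsewhere)` (the TEST IDÈLE). [folklore] -/
theorem uniformizerIdele_eq_mul :
    uniformizerIdele ℚ v ϖ =
      Units.map (algebraMap ℚ (FiniteAdeleRing (𝓞 ℚ) ℚ) : ℚ →* FiniteAdeleRing (𝓞 ℚ) ℚ) r *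
        ((Units.map (algebraMap ℚ (FiniteAdeleRing (𝓞 ℚ) ℚ) : ℚ →* FiniteAdeleRing (𝓞 ℚ) ℚ) r)⁻¹ *
          uniformizerIdele ℚ v ϖ) :=
  (mul_inv_cancel_left _ _).symm

omit hℓ in
/-- Components of the test idèle `y`: `y_w = (r⁻¹)_w · (ϖ at v, 1 elsewhere)_w`. [folklore] -/
theorem testIdele_apply (w : HeightOneSpectrum (𝓞 ℚ)) :
    (((Units.map (algebraMap ℚ (FiniteAdeleRing (𝓞 ℚ) ℚ) : ℚ →* FiniteAdeleRing (𝓞 ℚ) ℚ) r)⁻¹ *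
        uniformizerIdele ℚ v ϖ : (FiniteAdeleRing (𝓞 ℚ) ℚ)ˣ) : FiniteAdeleRing (𝓞 ℚ) ℚ) w =
      algebraMap ℚ (FiniteAdeleRing (𝓞 ℚ) ℚ) ((r : ℚ)⁻¹) w *
        (uniformizerIdele ℚ v ϖ : FiniteAdeleRing (𝓞 ℚ) ℚ) w := by
  rw [Units.val_mul, ← map_inv, Units.coe_map, Units.val_inv_eq_inv_val]
  rfl

omit hℓ in
/-- Components of `y⁻¹`: `y⁻¹_w = (ϖ⁻¹ at v, 1 elsewhere)_w · r_w`. [folklore] -/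
theorem testIdele_inv_apply (w : HeightOneSpectrum (𝓞 ℚ)) :
    (((((Units.map (algebraMap ℚ (FiniteAdeleRing (𝓞 ℚ) ℚ) : ℚ →* FiniteAdeleRing (𝓞 ℚ) ℚ) r)⁻¹ *
        uniformizerIdele ℚ v ϖ)⁻¹ : (FiniteAdeleRing (𝓞 ℚ) ℚ)ˣ)) : FiniteAdeleRing (𝓞 ℚ) ℚ) w =
      (uniformizerIdele ℚ v ϖ⁻¹ : FiniteAdeleRing (𝓞 ℚ) ℚ) w *
        algebraMap ℚ (FiniteAdeleRing (𝓞 ℚ) ℚ) (r : ℚ) w := by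
  rw [mul_inv_rev, inv_inv, map_inv, Units.val_mul, Units.coe_map]
  rfl

variable {r} (hr : (r : ℚ) = -(ℓ : ℚ))

include hℓ hv hr in
/-- For `r = -ℓ` and `ϖ` a uniformiser at `(ℓ)`, `y` and `y⁻¹` are integral at every place.
[folklore] -/
theorem testIdele_integral (hϖ : Valued.v ((ϖ : (v.adicCompletion ℚ)ˣ) : v.adicCompletion ℚ) =
      WithZero.exp (-1 : ℤ)) (w : HeightOneSpectrum (𝓞 ℚ)) :
    (((Units.map (algebraMap ℚ (FiniteAdeleRing (𝓞 ℚ) ℚ) : ℚ →* FiniteAdeleRing (𝓞 ℚ) ℚ) r)⁻¹ *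
        uniformizerIdele ℚ v ϖ : (FiniteAdeleRing (𝓞 ℚ) ℚ)ˣ) : FiniteAdeleRing (𝓞 ℚ) ℚ) w ∈
        w.adicCompletionIntegers ℚ ∧
      (((((Units.map (algebraMap ℚ (FiniteAdeleRing (𝓞 ℚ) ℚ) : ℚ →* FiniteAdeleRing (𝓞 ℚ) ℚ) r)⁻¹ *
        uniformizerIdele ℚ v ϖ)⁻¹ : (FiniteAdeleRing (𝓞 ℚ) ℚ)ˣ)) : FiniteAdeleRing (𝓞 ℚ) ℚ) w ∈
        w.adicCompletionIntegers ℚ := by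
  rw [HeightOneSpectrum.mem_adicCompletionIntegers, HeightOneSpectrum.mem_adicCompletionIntegers,
    testIdele_apply, testIdele_inv_apply, Valuation.map_mul, Valuation.map_mul,
    valued_algebraMap_apply, valued_algebraMap_apply, map_inv₀, hr, Valuation.map_neg]
  by_cases hw : w = v
  · subst hw
    rw [uniformizerIdele_apply_self, uniformizerIdele_apply_self, valuation_natCast_self hℓ hv, hϖ,
      Units.val_inv_eq_inv_val, map_inv₀, hϖ,
      inv_mul_cancel₀ (WithZero.exp_ne_zero : WithZero.exp (-1 : ℤ) ≠ 0)]
    exact ⟨le_rfl, le_rfl⟩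
  · rw [uniformizerIdele_apply_of_ne _ _ _ hw, uniformizerIdele_apply_of_ne _ _ _ hw,
      valuation_natCast_of_ne hv hw]
    simp

include hℓ hv hr in
/-- For `r = -ℓ`, at a place `w ≠ (ℓ)` with `ℓ + 1 ∈ 𝔭_w^n` both `y_w - 1` and `y_w⁻¹ - 1` have
valuation `≤ exp(-n)`. [folklore] -/
theorem testIdele_close {w : HeightOneSpectrum (𝓞 ℚ)} (hw : w ≠ v) {n : ℕ}
    (h : ((ℓ + 1 : ℕ) : 𝓞 ℚ) ∈ w.asIdeal ^ n) :
    Valued.v ((((Units.map (algebraMap ℚ (FiniteAdeleRing (𝓞 ℚ) ℚ) : ℚ →* FiniteAdeleRing (𝓞 ℚ) ℚ)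
        r)⁻¹ * uniformizerIdele ℚ v ϖ : (FiniteAdeleRing (𝓞 ℚ) ℚ)ˣ) : FiniteAdeleRing (𝓞 ℚ) ℚ) w - 1)
        ≤ WithZero.exp (-(n : ℤ)) ∧
      Valued.v ((((((Units.map (algebraMap ℚ (FiniteAdeleRing (𝓞 ℚ) ℚ) :
        ℚ →* FiniteAdeleRing (𝓞 ℚ) ℚ) r)⁻¹ * uniformizerIdele ℚ v ϖ)⁻¹ : (FiniteAdeleRing (𝓞 ℚ) ℚ)ˣ)) :
          FiniteAdeleRing (𝓞 ℚ) ℚ) w - 1) ≤ WithZero.exp (-(n : ℤ)) := by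
  have hℓ0 : (ℓ : ℚ) ≠ 0 := by exact_mod_cast hℓ.ne_zero
  have hvℓ : w.valuation ℚ (ℓ : ℚ) = 1 := valuation_natCast_of_ne hv hw
  have hsucc : w.valuation ℚ ((ℓ + 1 : ℕ) : ℚ) ≤ WithZero.exp (-(n : ℤ)) :=
    valuation_natCast_le_of_mem_pow h
  rw [testIdele_apply, testIdele_inv_apply, uniformizerIdele_apply_of_ne _ _ _ hw,
    uniformizerIdele_apply_of_ne _ _ _ hw, mul_one, one_mul, algebraMap_apply_sub_one,
    algebraMap_apply_sub_one, valued_algebraMap_apply, valued_algebraMap_apply, hr]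
  constructor
  · have e1 : (-(ℓ : ℚ))⁻¹ - 1 = -(((ℓ + 1 : ℕ) : ℚ) * (ℓ : ℚ)⁻¹) := by
      push_cast
      field_simp
      ring
    rw [e1, Valuation.map_neg, Valuation.map_mul, map_inv₀, hvℓ, inv_one, mul_one]
    exact hsucc
  · have e2 : (-(ℓ : ℚ)) - 1 = -(((ℓ + 1 : ℕ) : ℚ)) := by
      push_cast
      ring
    rw [e2, Valuation.map_neg]
    exact hsucc

end RatPlaces

end Summit.Langlands.Langlands.Theorems.MonomialSerreAtSplitPrimes.Negative

end
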